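import Summits.BirchSwinnertonDyer.BirchSwinnertonDyer.Theorems.AdditiveBranchIMCGordTwoRankOneWanAnyRoadDefs
import Summits.BirchSwinnertonDyer.BirchSwinnertonDyer.Theorems.AdditiveBranchIMCGordTwoRankZeroOffCaseOneTwistRowTameClosed
import Summits.BirchSwinnertonDyer.BirchSwinnertonDyer.Theorems.AdditiveBranchIMCTameBranchSocketOfFlat
import Summits.BirchSwinnertonDyer.BirchSwinnertonDyer.Theorems.AdditiveBranchIMCGordTwoRankZeroOffCaseOneFieldSupplyR0TameTwist
import Literature.NumberTheory.EllipticCurves.YanZhu2026.TwistGoodOrdinaryProofs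
import Literature.NumberTheory.EllipticCurves.RootNumberProofs
import Literature.NumberTheory.DiophantineGeometry.LocalReduction
import HarnessLib

/-!
# The dyadic Wan road (crux `AdditiveBranchIMC.GordTwoRankOne`, line `wan_tame_bdp_road`), file 1/5 `Field`: the road field over a Wan prime of ANY parity
# — the odd road field is one, the dyadic supply `FieldOneTwo` gives one, and the parity reads R1 (input) / R3 discharged

* `tameRoadFieldAny_of_tameRoadField` — `TameRoadField → TameRoadFieldAny` (read R2 moved into the predicate: `d_K < -4`);
* `tameRoadFieldAny_two` — what `FieldOneTwo` (at `B := 4`) delivers is a road field with Wan prime `2`;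
* `two_lt_ringChar_of_mult_two`, `h2tt_of_mult_two` — `E` multiplicative at `2` has no additive place above `2` (read R1's input);
* `cellGordTwo_tameTwist_discr` — read R3 discharged: cell (G-ord, `e = 2`) transports along the twist by ANY fundamental `d_K` with `p` split
  (`isOrdinaryAt_of_smul_eq_quadraticTwist_discr`).

PROVENANCE: this is the pen's CHECKED, SORRY-FREE port `Cruxes/GordTwoRankOne/WanAnyRoadPort.lean` v1 (planner bsd-addord-plan g44, E354, crux commit
8edfc766c5d5, sha256 8cb68225fc3c8710, lean check rc 0 / 0 sorries), landed Theorems-side by seat prover-bsd-addord-stub-1-g0 per the recipe e18 §5 (director-bsd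
(587)(B)); namespace `…Cruxes.GordTwoRankOne.WanTameBdpRoad.Port` ↦ `…Theorems.WanAnyRoad`, vocabulary from `AdditiveBranchIMCGordTwoRankOneWanAnyRoadDefs`, split
into ≤ 400-line files (`…WanAnyRoad{Field,Flat,Socket,StepL,ClosedHL}`); proofs byte-identical otherwise. BSD is proved for no curve by any of this.
References: [JetchevSkinnerWan2017] §7.4.1 (arXiv:1512.06894 p. 30); [CastellaLiuWan2022] Thm. 8.2.1 (1), §6.1; [Hsieh2014] Thm. B; [LiuZhangZhang2018]
Thm. 1.5.1/1.5.3; [CaiShuTian2014] Thm. 1.1; [HoffsteinLuo1997] Theorem (§1); [SkinnerUrban2014] Thm. 3.6.4.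
-/

set_option autoImplicit false
set_option linter.dupNamespace false

noncomputable section

open scoped Classical
open NumberField IsDedekindDomain IsDedekindDomain.HeightOneSpectrum Rat.HeightOneSpectrum
open WeierstrassCurve Literature.NumberTheory.EllipticCurves
open Literature.NumberTheory.EllipticCurves.Rank1Residual
open Literature.NumberTheory.QuadraticFields
open Summit.BirchSwinnertonDyer.Rank1Residual
open Summit.BirchSwinnertonDyer.Rank1Residual.Additive
open Summit.BirchSwinnertonDyer.BirchSwinnertonDyer.Theorems
open ThreeFieldRoadSupply

namespace Summit.BirchSwinnertonDyer.BirchSwinnertonDyer.Theorems.WanAnyRoad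

/-! ### §2 The odd road field is a road field (read (R2) moved into the predicate) -/

/-- `TameRoadField → TameRoadFieldAny`: drop the parity clause of the Wan prime and record `d_K < -4`
(`TameBranchSocket.discr_lt_neg_four_of_tameRoadField`). [folklore] -/
theorem tameRoadFieldAny_of_tameRoadField {W : WeierstrassCurve ℚ} [W.IsGloballyMinimal] {p : ℕ}
    {K : Type} [Field K] [NumberField K] (hK : TameRoadField W p K) : TameRoadFieldAny W p K := by
  have hd4 : NumberField.discr K < -4 := TameBranchSocket.discr_lt_neg_four_of_tameRoadField hK
  obtain ⟨hKiq, ⟨q, hqF, hWan, hqd, hsplitq⟩, h2split, hpK⟩ := hK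
  exact ⟨hKiq, hd4, ⟨q, hqF, ⟨hWan.1, hWan.2.2.1, hWan.2.2.2.1, hWan.2.2.2.2⟩, hqd, hsplitq⟩, h2split, hpK⟩

/-! ### §3 The dyadic instance (what `FieldOneTwo` delivers, with `B := 4`) -/

/-- **The field of `FieldOneTwo` is a road field with Wan prime `2`.** `K` imaginary quadratic, `4 < |d_K|`,
`2 ∣ d_K`, every odd prime of `N_E` split, `p` split, and `2` a Wan prime of `E` (in particular `2 ∣ N_E`, so
the clause «`2` split if `2 ∤ N_E`» is vacuous). [folklore] -/
theorem tameRoadFieldAny_two {W : WeierstrassCurve ℚ} [W.IsElliptic] [W.IsGloballyMinimal] {p : ℕ}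
    {K : Type} [Field K] [NumberField K] (hKiq : IsImaginaryQuadratic K)
    (hB : 4 < (NumberField.discr K).natAbs) (h2d : (2 : ℤ) ∣ NumberField.discr K)
    (hsplit : ∀ ℓ : ℕ, ℓ.Prime → ℓ ∣ W.conductorNorm ℤ → ℓ ≠ 2 →
      ((Ideal.span {(ℓ : ℤ)}).primesOver (𝓞 K)).ncard = 2)
    (hpK : SatisfiesHeegnerHypothesis p K) (hWan : WanPrimeAny W p 2) : TameRoadFieldAny W p K := by
  haveI : IsTotallyComplex K := hKiq.2
  have hneg : NumberField.discr K < 0 := discr_neg_of_finrank_eq_two K hKiq.1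
  have hd4 : NumberField.discr K < -4 := by
    have habs : ((NumberField.discr K).natAbs : ℤ) = -NumberField.discr K :=
      Int.ofNat_natAbs_of_nonpos hneg.le
    omega
  have h2N : 2 ∣ W.conductorNorm ℤ := (TameBranchSocket.dvd_and_not_sq_dvd_of_mult hWan.2.1).1
  exact ⟨hKiq, hd4, ⟨2, ⟨Nat.prime_two⟩, hWan, h2d, hsplit⟩, fun h ↦ absurd h2N h, hpK⟩

/-! ### §4 Read (R1)'s input: multiplicative at `2` ⟹ no additive place above `2` -/

/-- `natGenerator` of the place of `ℤ` under a prime is that prime. [folklore] -/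
private theorem natGenerator_symm (q : Nat.Primes) : natGenerator ((primesEquiv (R := ℤ)).symm q) = q :=
  congrArg (fun q : Nat.Primes ↦ (q : ℕ)) ((primesEquiv (R := ℤ)).apply_symm_apply q)

/-- **A curve multiplicative at `2` has no additive reduction above `2`** — the `h2` binder of
`TwistTypePartnerDataOdd.exists_semistable_partner_data_odd` on the dyadic Wan sub-row. [folklore] -/
theorem two_lt_ringChar_of_mult_two (W : WeierstrassCurve ℚ) [W.IsElliptic]
    (hm : W.HasMultiplicativeReductionAtPrime 2)
    (v : HeightOneSpectrum ℤ) (hadd : W.HasAdditiveReductionAt v) : 2 < ringChar (ℤ ⧸ v.asIdeal) := by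
  obtain ⟨r, rfl⟩ := (primesEquiv (R := ℤ)).symm.surjective v
  rw [Rat.ringChar_int_quotient_asIdeal, natGenerator_symm]
  have hr2 : (r : ℕ) ≠ 2 := by
    intro h
    have hr : r = ⟨2, Nat.prime_two⟩ := Subtype.ext h
    subst hr
    exact hadd.not_hasMultiplicativeReductionAt
      ((W.hasMultiplicativeReductionAtPrime_iff_hasMultiplicativeReductionAt_holds ⟨2, Nat.prime_two⟩).mp hm)
  have h2le : 2 ≤ (r : ℕ) := r.2.two_le
  omega

/-- **On the dyadic Wan sub-row the dyadic twist-type binder `h2tt` is vacuous**: no additive place above `2`.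
[folklore] -/
theorem h2tt_of_mult_two (W : WeierstrassCurve ℚ) [W.IsElliptic]
    (hm : W.HasMultiplicativeReductionAtPrime 2) :
    ∀ r : Nat.Primes, (r : ℕ) = 2 → W.HasAdditiveReductionAt ((primesEquiv (R := ℤ)).symm r) →
      ∃ t : ℤ, (t = -1 ∨ t = 2 ∨ t = -2) ∧
        ¬ (W.quadraticTwist (t : ℚ)).HasAdditiveReductionAt ((primesEquiv (R := ℤ)).symm r) := by
  intro r hr2 ha
  have h3 := two_lt_ringChar_of_mult_two W hm _ ha
  rw [Rat.ringChar_int_quotient_asIdeal, natGenerator_symm, hr2] at h3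
  exact absurd h3 (lt_irrefl 2)

/-! ### §5 Read (R3) discharged: cell (G-ord, `e = 2`) transports along the twist by ANY `d_K` -/

/-- **Cell (G-ord, `e = 2`) transports along the tame twist, `d_K` of any shape** (`p ≥ 5` split in `K`;
`Wd = Cd • E^{(d_K)}` globally minimal): `N10.CellGordTwo W p → N10.CellGordTwo Wd p`. Verbatim
`ThreeFieldRoadSupply.cellGordTwo_tameTwist` with its one use of «`2` split» (square-free `d_K` for
`isOrdinaryAt_of_smul_eq_quadraticTwist`) replaced by `isOrdinaryAt_of_smul_eq_quadraticTwist_discr`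
(`d_K` square-free or `4m`: twist by `m`). [cite: SilvermanAEC2009, X.5 Cor. 5.4 and VII.5 Prop. 5.1] -/
theorem cellGordTwo_tameTwist_discr (W : WeierstrassCurve ℚ) [W.IsElliptic] [W.IsGloballyMinimal] (p : ℕ)
    [hp : Fact p.Prime] (K : Type) [Field K] [NumberField K]
    {Wd : WeierstrassCurve ℚ} [Wd.IsElliptic] [Wd.IsGloballyMinimal]
    (hp5 : 5 ≤ p) (hK : IsImaginaryQuadratic K) (hpK : SatisfiesHeegnerHypothesis p K)
    (Cd : VariableChange ℚ) (hWd : Cd • W.quadraticTwist (NumberField.discr K : ℚ) = Wd)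
    (hcell : N10.CellGordTwo W p) : N10.CellGordTwo Wd p := by
  have hp2 : p ≠ 2 := by omega
  have hdZ : NumberField.discr K ≠ 0 := NumberField.discr_ne_zero K
  have hD0 : (NumberField.discr K : ℚ) ≠ 0 := by exact_mod_cast hdZ
  obtain ⟨hsq, hpd⟩ := isSquare_and_not_dvd_of_split p K hK hp2 hpK
  obtain ⟨-, hadd, hG, he⟩ := hcell
  -- `Addv` and `ord_p Δ_min`
  have hsq' : IsSquare (((NumberField.discr K : ℚ) : ℚ) : ℚ_[p]) := by simpa using hsq
  have haddd : Addv Wd p := (AdditivePotMult.addv_iff_of_twist hD0 hsq' Wd hWd).mpr hadd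
  have hΔ : padicValInt p Wd.minimalDiscriminantInt = padicValInt p W.minimalDiscriminantInt :=
    X11b.padicValInt_minimalDiscriminantInt_twist_eq W p hD0 hsq Cd hWd
  have hed : semistabilityIndex Wd p = 2 := by
    unfold semistabilityIndex at he ⊢
    rw [hΔ]
    exact he
  refine ⟨hp2, haddd, ?_, hed⟩
  -- (G)-ordinary via the `p*`-partners
  set ps : ℚ := (-1 : ℚ) ^ (p / 2) * p with hps
  have hps0 : ps ≠ 0 := mul_ne_zero (pow_ne_zero _ (by norm_num)) (by exact_mod_cast hp.out.ne_zero)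
  obtain ⟨V, iV, iVm, CV, hCV⟩ := exists_isGloballyMinimal_smul_eq_quadraticTwist W hps0
  have hV : CV⁻¹ • W.quadraticTwist ps = V := by rw [← hCV, inv_smul_smul]
  have hordV : GoodOrd V p := (typeGOrd_iff_goodOrd_twist_pStar W p hp5 he V CV⁻¹ hV).mp hG
  obtain ⟨Vd, iVd, iVdm, CVd, hCVd⟩ := exists_isGloballyMinimal_smul_eq_quadraticTwist V hD0
  have hordVd : IsOrdinaryAt Vd p :=
    isOrdinaryAt_of_smul_eq_quadraticTwist_discr hK.1 V Vd hCVd p hp2 hpd ⟨hordV.1, hordV.2⟩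
  have hgoVd : GoodOrd Vd p := ⟨hordVd.1, hordVd.2⟩
  -- `Vd` is a model of `Wd^{(p*)}`: `Wd^{(p*)} ≅ E^{(d_K p*)} ≅ (E^{(p*)})^{(d_K)} ≅ V^{(d_K)} ≅ Vd`
  have h1 : ∃ C : VariableChange ℚ, C • Wd.quadraticTwist ps = Vd := by
    have e1 : Wd.quadraticTwist ps =
        (⟨Cd.u, ps * Cd.r, 0, 0⟩ : VariableChange ℚ) • W.quadraticTwist ((NumberField.discr K : ℚ) * ps) := by
      rw [← hWd, WeierstrassCurve.quadraticTwist_smul, quadraticTwist_quadraticTwist]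
    have e2 : V.quadraticTwist (NumberField.discr K : ℚ) =
        (⟨CV⁻¹.u, (NumberField.discr K : ℚ) * CV⁻¹.r, 0, 0⟩ : VariableChange ℚ) •
          W.quadraticTwist (ps * (NumberField.discr K : ℚ)) := by
      rw [← hV, WeierstrassCurve.quadraticTwist_smul, quadraticTwist_quadraticTwist]
    refine ⟨CVd⁻¹ * (⟨CV⁻¹.u, (NumberField.discr K : ℚ) * CV⁻¹.r, 0, 0⟩ : VariableChange ℚ) *
      (⟨Cd.u, ps * Cd.r, 0, 0⟩ : VariableChange ℚ)⁻¹, ?_⟩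
    rw [mul_smul, mul_smul, e1, inv_smul_smul, mul_comm (NumberField.discr K : ℚ) ps, ← e2, ← hCVd,
      inv_smul_smul]
  obtain ⟨C₃, hC₃⟩ := h1
  exact (typeGOrd_iff_goodOrd_twist_pStar Wd p hp5 hed Vd C₃ hC₃).mpr hgoVd



end Summit.BirchSwinnertonDyer.BirchSwinnertonDyer.Theorems.WanAnyRoad

end
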